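import Mathlib
import HarnessLib
import Summits.Ventures.LatticeQCDFlow.Scoring.FreeFieldHMCAutocorrelation

/-!
# A fixed-footprint map inside HMC keeps `z = 2` on the free field and buys a constant factor in the UV

HONEST FRAMING: exact (Metropolis-corrected) sampling algorithms for lattice gauge theory;
figures of merit are autocorrelation/cost numbers at stated couplings and volumes; no
continuum-physics claim.  (FREE-FIELD shadow of a CP(N−1) rung: not a gauge result.)

Venture `LatticeQCDFlow` (cell pub-lqcd), sub-topic `Scoring`; FANOUT row 7 (`s0-cpn-null`, S0-D1:
2D CP⁹, the leading-order trivializing map used INSIDE HMC vs HMC at equal cost; printed finding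
reproduced blind: the map shortens τ_int(Q²) by a constant factor, costs a constant factor per
trajectory, and leaves the scaling exponent unchanged).  NEW WORK of the cell over the tree's
`Scoring/FreeFieldHMCAutocorrelation.lean` (row 2: the acceptance-one HMC skeleton on a free mode
of frequency `Ω²` at fixed trajectory length `T = Nδ` has `τ_int = (1 + c)/(2(1 − c)) ≥
(1 + c)/(T²Ω²)`, `c = cos(Nθ)`; the magnetisation mode `Ω₀² = 2m²` gives `z ≥ 2`); nothing is
cited as a fact.  Printed counterparts, named only: Lüscher 2010 §5 (the leading order of the
trivializing flow is the gradient flow of the action, run for a FIXED flow time in lattice units),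
Engel–Schaefer 2011 §5–§6 ("the result is negative": reduced forces and autocorrelation times,
scaling towards the continuum unchanged), Kennedy–Pendleton 1991 (free-field HMC mode analysis).

## The free-field shadow of the rung

For the free action `S = ½ Σ_p Ω_p² |φ_p|²` the gradient ("Wilson") flow is `φ_p ↦ e^{−tΩ_p²} φ_p`
and its leading order in `t` — Lüscher's LO map — is the mode-wise LINEAR map `U_p = (1 − tΩ_p²) V_p`.
For ANY mode-wise linear map `U = aV` the modified action is `S̃(V) = S(aV) − log|a| =
½(a²Ω²)V² + const` (`modifiedMode_action_sub_log`): HMC in the `V`-variables is free-field HMC at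
the MODIFIED FREQUENCY `Ω̃² = a²Ω²`, and since `U_t = aV_t` pathwise the normalised autocorrelation
function of the `U`-mode IS that of the `V`-mode (`acf_scale_invariant`).  Hence, mode by mode, the
tree's skeleton theorems apply verbatim at `Ω̃²`:

* IR (the null result): **`transformed_tauInt_magnetisation_ge`** — for every map factor with
  `a² ≤ 1`, `a ≠ 0` (the LO map `a = 1 − t·2m²` for `0 ≤ 2tm² ≤ 2`, `loMap_factor_sq_le_one`; the
  exact flow map `a = e^{−t·2m²}`, `t ≥ 0`, `flowMap_factor_sq_le_one`) the magnetisation mode of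
  the TRANSFORMED chain still obeys `τ_int(M) ≥ (1 + c̃)·ξ²/(2T²)` at fixed trajectory length:
  **`z ≥ 2` persists under the map, for every fixed flow time `t` in lattice units**
  (`loMap_tauInt_magnetisation_ge`, `flowMap_tauInt_magnetisation_ge`).  The reason in one line:
  `loMap_soft_transparency` — the map is transparent to the soft mode, `Ω̃₀²/Ω₀² = (1 − 2tm²)² ≥
  1 − 4t/ξ²`, a map of fixed footprint cannot see the scale `ξ`.
* UV (the constant factor): `mul_one_sub_sq_le` (`x(1 − x)² ≤ 4/27` for `x ≤ 4/3`, equality at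
  `x = 1/3`), **`loMap_uv_compression`** — at flow time `t` every mode with `tΩ² ≤ 1` is mapped to
  `Ω̃² = (1 − tΩ²)²Ω² ≤ (4/27)/t`: with `t = 1/Ω²_max` the whole modified spectrum sits below
  `(4/27)Ω²_max` (`loMap_kills_top_mode`: the top mode is mapped to frequency ZERO); hence
  **`loMap_stability`** — the leapfrog stability condition `δ²Ω̃² < 4` holds for every mode with a
  step `δ̃² ≤ (27/4)δ²` whenever `δ²Ω²_max < 4` did: `√(27/4) ≈ 2.6×` fewer force evaluations per
  trajectory at fixed `T`, against the map's constant cost per evaluation — a `ξ`-INDEPENDENT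
  trade, on both sides.

So on the free field the two halves of the printed finding are theorems of the skeleton: constant
factors from the UV, the `ξ²` law from the IR, untouched.  What carries over to CP(N−1)/gauge
theories is the mechanism, not the numbers (there the slow mode is topological, not Gaussian).

NOT CLAIMED: anything about the Metropolis-corrected chain beyond its acceptance-one skeleton (as
in the imported file), interacting theories, or the actual cost balance of the rung (measured, not
derived: ×1.6 per trajectory, τ_int(Q²) ×0.7–0.9).
-/

namespace Summit.Ventures.LatticeQCDFlow.Scoring

open Real

/-! ## §1 A mode-wise linear map gives a free mode of modified frequency -/

/-- The pulled-back free action of the linear mode map `U = aV`: `½Ω²(aV)² = ½(a²Ω²)V²`. -/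
theorem modifiedMode_action (w2 a V : ℝ) : w2 * (a * V) ^ 2 / 2 = a ^ 2 * w2 * V ^ 2 / 2 := by
  ring

/-- Lüscher's modified action `S̃(V) = S(aV) − log|a|` of the linear mode map is the free action of
frequency `a²Ω²` plus a FIELD-INDEPENDENT constant (the Jacobian of a linear map): HMC for `S̃`
is free-field HMC at the modified frequency — same forces, same trajectories. -/
theorem modifiedMode_action_sub_log (w2 a V : ℝ) :
    w2 * (a * V) ^ 2 / 2 - Real.log |a| = a ^ 2 * w2 * V ^ 2 / 2 + -Real.log |a| := by
  ring

/-- **Normalised autocorrelations are blind to the scale of the observable**: reading `U = aV`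
instead of `V` multiplies every lag covariance `C(t)` by `a²`, so `ρ(t) = C(t)/C(0)` — and with it
`τ_int` — is unchanged (`a ≠ 0`).  The `U`-mode of the transformed chain and the `V`-mode of the
HMC chain for `S̃` have the same `τ_int`. -/
theorem acf_scale_invariant {a : ℝ} (ha : a ≠ 0) (C : ℕ → ℝ) (t : ℕ) :
    a ^ 2 * C t / (a ^ 2 * C 0) = C t / C 0 :=
  mul_div_mul_left _ _ (pow_ne_zero 2 ha)

/-! ## §2 The maps: leading-order and exact gradient flow, mode by mode -/

/-- The LO map factor satisfies `(1 − tΩ²)² ≤ 1` for `0 ≤ tΩ² ≤ 2`: the map never RAISES a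
frequency in that band. -/
theorem loMap_factor_sq_le_one {t w2 : ℝ} (h0 : 0 ≤ t * w2) (h2 : t * w2 ≤ 2) :
    (1 - t * w2) ^ 2 ≤ 1 := by
  nlinarith

/-- The exact gradient-flow factor satisfies `(e^{−tΩ²})² ≤ 1` for `t ≥ 0`, `Ω² ≥ 0`. -/
theorem flowMap_factor_sq_le_one {t w2 : ℝ} (ht : 0 ≤ t) (hw : 0 ≤ w2) :
    Real.exp (-(t * w2)) ^ 2 ≤ 1 := by
  have h1 : Real.exp (-(t * w2)) ≤ 1 := Real.exp_le_one_iff.mpr (by nlinarith)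
  have h0 : 0 ≤ Real.exp (-(t * w2)) := (Real.exp_pos _).le
  nlinarith

/-- **Soft-mode transparency**: on the magnetisation mode `Ω₀² = 2m² = 2/ξ²` the LO map's squared
factor is `(1 − 2tm²)² ≥ 1 − 4tm²` — within `4t/ξ²` of the identity.  A map of fixed flow time
(fixed footprint in lattice units) does not see the scale `ξ`. -/
theorem loMap_soft_transparency (t m2 : ℝ) : 1 - 4 * t * m2 ≤ (1 - t * (2 * m2)) ^ 2 := by
  nlinarith [sq_nonneg (t * (2 * m2))]

/-! ## §3 IR: `z ≥ 2` persists under the map -/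

/-- **`z ≥ 2` persists under any frequency-non-raising mode map.**  Magnetisation mode
`Ω₀² = 2m²` (`ξ² = 1/m²`), map factor `a` with `a ≠ 0`, `a² ≤ 1`, so the transformed chain is the
HMC skeleton at `Ω̃₀² = a²·2m²`; trajectories of `N ≥ 1` steps of size `δ` (`T = Nδ`, stable for the
ORIGINAL mode, hence for the modified one), non-resonant modified mode (`|c̃| < 1`).  Then
`τ_int(M) ≥ (1 + c̃)·ξ²/(2T²)` — the same `ξ²` law as without the map
(`tauInt_magnetisation_ge`). -/
theorem transformed_tauInt_magnetisation_ge {δ m2 a : ℝ} (hδ : 0 < δ) (hm : 0 < m2) (ha : a ≠ 0)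
    (ha1 : a ^ 2 ≤ 1) (hst : δ ^ 2 * (2 * m2) < 4) {N : ℕ} (hN : 1 ≤ N)
    (hc : |Real.cos (N * Real.arccos (1 - δ ^ 2 * (a ^ 2 * (2 * m2)) / 2))| < 1) :
    (1 + Real.cos (N * Real.arccos (1 - δ ^ 2 * (a ^ 2 * (2 * m2)) / 2))) * (1 / m2)
        / (2 * (N * δ) ^ 2)
      ≤ tauInt (fun t => Real.cos (N * Real.arccos (1 - δ ^ 2 * (a ^ 2 * (2 * m2)) / 2)) ^ t) := by
  have ha2 : 0 < a ^ 2 := by positivity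
  have hw' : 0 < a ^ 2 * (2 * m2) := by positivity
  have hδm : 0 ≤ δ ^ 2 * (2 * m2) := by positivity
  have hst' : δ ^ 2 * (a ^ 2 * (2 * m2)) < 4 := by
    calc δ ^ 2 * (a ^ 2 * (2 * m2)) = a ^ 2 * (δ ^ 2 * (2 * m2)) := by ring
      _ ≤ 1 * (δ ^ 2 * (2 * m2)) := by gcongr
      _ < 4 := by linarith
  have h := unadjusted_tauInt_ge hδ hw' hst' hN hc
  set c := Real.cos (N * Real.arccos (1 - δ ^ 2 * (a ^ 2 * (2 * m2)) / 2)) with hc_def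
  have hc1 : 0 ≤ 1 + c := by linarith [(abs_lt.mp hc).1]
  have hN' : (0 : ℝ) < N := by exact_mod_cast hN
  have hNδ : 0 < (N * δ) ^ 2 := by positivity
  calc (1 + c) * (1 / m2) / (2 * (N * δ) ^ 2) = (1 + c) / ((N * δ) ^ 2 * (2 * m2)) := by
        field_simp
    _ ≤ (1 + c) / ((N * δ) ^ 2 * (a ^ 2 * (2 * m2))) := by
        apply div_le_div_of_nonneg_left hc1 (by positivity)
        calc (↑N * δ) ^ 2 * (a ^ 2 * (2 * m2)) = a ^ 2 * ((↑N * δ) ^ 2 * (2 * m2)) := by ring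
          _ ≤ 1 * ((↑N * δ) ^ 2 * (2 * m2)) := by gcongr
          _ = (↑N * δ) ^ 2 * (2 * m2) := one_mul _
    _ ≤ _ := h

/-- **The LO trivializing map inside HMC keeps `z ≥ 2`** (free field, skeleton): flow time `t`
with `0 ≤ t`, `2tm² ≤ 2` and `2tm² ≠ 1`, factor `a = 1 − t·2m²` on the magnetisation mode. -/
theorem loMap_tauInt_magnetisation_ge {δ m2 t : ℝ} (hδ : 0 < δ) (hm : 0 < m2) (ht : 0 ≤ t)
    (ht2 : t * (2 * m2) ≤ 2) (hne : t * (2 * m2) ≠ 1) (hst : δ ^ 2 * (2 * m2) < 4) {N : ℕ}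
    (hN : 1 ≤ N)
    (hc : |Real.cos (N * Real.arccos (1 - δ ^ 2 * ((1 - t * (2 * m2)) ^ 2 * (2 * m2)) / 2))| < 1) :
    (1 + Real.cos (N * Real.arccos (1 - δ ^ 2 * ((1 - t * (2 * m2)) ^ 2 * (2 * m2)) / 2)))
        * (1 / m2) / (2 * (N * δ) ^ 2)
      ≤ tauInt (fun s =>
          Real.cos (N * Real.arccos (1 - δ ^ 2 * ((1 - t * (2 * m2)) ^ 2 * (2 * m2)) / 2)) ^ s) :=
  transformed_tauInt_magnetisation_ge hδ hm (sub_ne_zero.mpr (Ne.symm hne))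
    (loMap_factor_sq_le_one (by positivity) ht2) hst hN hc

/-- **Even the exact gradient-flow map at fixed flow time keeps `z ≥ 2`**: factor
`a = e^{−t·2m²}`, `t ≥ 0`. -/
theorem flowMap_tauInt_magnetisation_ge {δ m2 t : ℝ} (hδ : 0 < δ) (hm : 0 < m2) (ht : 0 ≤ t)
    (hst : δ ^ 2 * (2 * m2) < 4) {N : ℕ} (hN : 1 ≤ N)
    (hc : |Real.cos (N * Real.arccos
        (1 - δ ^ 2 * (Real.exp (-(t * (2 * m2))) ^ 2 * (2 * m2)) / 2))| < 1) :
    (1 + Real.cos (N * Real.arccos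
        (1 - δ ^ 2 * (Real.exp (-(t * (2 * m2))) ^ 2 * (2 * m2)) / 2))) * (1 / m2)
        / (2 * (N * δ) ^ 2)
      ≤ tauInt (fun s => Real.cos (N * Real.arccos
          (1 - δ ^ 2 * (Real.exp (-(t * (2 * m2))) ^ 2 * (2 * m2)) / 2)) ^ s) :=
  transformed_tauInt_magnetisation_ge hδ hm (Real.exp_pos _).ne'
    (flowMap_factor_sq_le_one ht (by positivity)) hst hN hc

/-! ## §4 UV: the map compresses the hard modes by a constant factor -/

/-- The cubic bound `x(1 − x)² ≤ 4/27` for `x ≤ 4/3` (`4/27 − x(1 − x)² = (3x − 1)²(4 − 3x)/27`). -/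
theorem mul_one_sub_sq_le {x : ℝ} (hx : x ≤ 4 / 3) : x * (1 - x) ^ 2 ≤ 4 / 27 := by
  nlinarith [sq_nonneg (3 * x - 1), mul_nonneg (sq_nonneg (3 * x - 1)) (by linarith : 0 ≤ 4 - 3 * x)]

/-- … with equality at `x = 1/3`. -/
theorem mul_one_sub_sq_third : (1 / 3 : ℝ) * (1 - 1 / 3) ^ 2 = 4 / 27 := by norm_num

/-- **UV compression by the LO map.**  At flow time `t > 0`, every mode with `tΩ² ≤ 1` is mapped to
the modified frequency `Ω̃² = (1 − tΩ²)²Ω² ≤ (4/27)·(1/t)`: with `t = 1/Ω²_max` the whole modified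
spectrum lies below `(4/27)Ω²_max` (no sign condition on `Ω²` is needed for the inequality). -/
theorem loMap_uv_compression {t w2 : ℝ} (ht : 0 < t) (hw : t * w2 ≤ 1) :
    (1 - t * w2) ^ 2 * w2 ≤ 4 / 27 * (1 / t) := by
  have hx := mul_one_sub_sq_le (x := t * w2) (by linarith)
  have e : (1 - t * w2) ^ 2 * w2 = 1 / t * (t * w2 * (1 - t * w2) ^ 2) := by
    field_simp
  rw [e, mul_comm (4 / 27 : ℝ)]
  exact mul_le_mul_of_nonneg_left hx (one_div_pos.mpr ht).le

/-- The top mode is mapped to frequency ZERO when `tΩ² = 1` (the LO map over-smooths it exactly). -/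
theorem loMap_kills_top_mode {t w2 : ℝ} (h : t * w2 = 1) : (1 - t * w2) ^ 2 * w2 = 0 := by
  rw [h]; ring

/-- **Leapfrog stability is relaxed by the constant factor `27/4`.**  If the step `δ` is stable for
the ORIGINAL top frequency `Ω²_max = 1/t` (`δ²Ω²_max < 4`), then any step `δ̃` with
`δ̃² ≤ (27/4)δ²` is stable for EVERY modified mode `Ω̃² = (1 − tΩ²)²Ω²`, `0 ≤ Ω² ≤ Ω²_max`:
`δ̃²Ω̃² < 4`.  At fixed trajectory length: `≈ 2.6×` fewer force evaluations — a `ξ`-independent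
factor, to be paid against the map's `ξ`-independent cost per evaluation. -/
theorem loMap_stability {t w2 δ δ' : ℝ} (ht : 0 < t) (hw0 : 0 ≤ w2) (hw : t * w2 ≤ 1)
    (hstab : δ ^ 2 * (1 / t) < 4) (hδ' : δ' ^ 2 ≤ 27 / 4 * δ ^ 2) :
    δ' ^ 2 * ((1 - t * w2) ^ 2 * w2) < 4 := by
  have hc := loMap_uv_compression ht hw
  have hnn : 0 ≤ (1 - t * w2) ^ 2 * w2 := by positivity
  calc δ' ^ 2 * ((1 - t * w2) ^ 2 * w2) ≤ 27 / 4 * δ ^ 2 * (4 / 27 * (1 / t)) :=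
        mul_le_mul hδ' hc hnn (by positivity)
    _ = δ ^ 2 * (1 / t) := by ring
    _ < 4 := hstab

end Summit.Ventures.LatticeQCDFlow.Scoring
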